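import Summits.AtomisticToContinuum.HydrodynamicLimit.Theorems.RelayRaceLocalityNearConstantShortTimeHLWeightedCellRows
import Summits.AtomisticToContinuum.HydrodynamicLimit.Theorems.RelayRaceLocalityNearConstantShortTimeHLWeightedCellSizes
import Summits.AtomisticToContinuum.HydrodynamicLimit.Theorems.RelayRaceLocalityNearConstantShortTimeHLFluxRemainder
import Summits.AtomisticToContinuum.HydrodynamicLimit.Theorems.RelayRaceLocalityNearConstantShortTimeHLFluxIntegrabilityB
import HarnessLib

/-!
# Crux `NearConstantShortTimeHL` (stmt-AtomisticToContinuum-12502), line `small-tilt-domination`: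
# stub `weightedCell_bound` — the pathwise cell bound of the discretised relative-entropy Grönwall

Lead c4, stub `weightedCell_bound` of the Grönwall assembly of the crux
`…Theses.RelayRaceLocality.NearConstantShortTimeHL` (route: Yau's relative-entropy method for
deterministic hard spheres; the Grönwall inequality is discretised on a grid of time cells).  Along
ONE good hard-sphere orbit `r ↦ Φ_r z` obeying the ball-packing cap `ρ̃σ³ ≤ η₁ < η₀` on a cell
`[s, s+τ] ⊆ [0, t]`, integrating the log-profile observable `X_r = ρ_N[λ⁰_r] + Σⱼ m_N[λ_{r,j}]ⱼ + e_N[λ⁴_r]`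
over the cell against its left-endpoint value produces, by the three weak balance rows with the
TIME-WEIGHTED tests `(s+τ−r)λ⁰_r`, `(s+τ−r)•λ_r`, `(s+τ−r)λ⁴_r`, exactly the two weighted closure
defects plus a short-cell remainder:

`|∫_s^{s+τ} X_r(Φ_r z) dr − τ X_s(Φ_s z) − momDefect[(s+τ−r)•λ] − enDefect[(s+τ−r)λ⁴]|`
`   ≤ C τ (τ (1 + K(z)) + ∫_s^{s+τ} n⁻¹Σᵢ‖vᵢ(r)‖³ dr)`,

`C = Λ(30 + 6Z)` depending on the solution data on `[0, t]` only (`Λ` = the coefficient bound of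
`wb_coeffs`, `Z` = the compressibility bound on `[0, η₁]`), together with the interval integrability of
`r ↦ X_r(Φ_r z)` and of the cubic moment on the cell.  Proof (bookkeeping, no Dafermos expansion):
MASS ROW exact (`weightedCell_massRow`, part A); MOMENTUM and ENERGY ROWS by definition of the closure
defects with the weighted tests (`xs_momDefect_weighted`, `xs_enDefect_weighted` below: the tests vanish
at `s+τ`, equal `τλ_s`, `τλ⁴_s` at `s`, and `∂ₜ((s+τ−r)f) = −f + (s+τ−r)∂ₜf`); summing, the `−row`
parts give `−∫X`, the endpoint parts `−τX_s`, and what is left is `∫_s^{s+τ}(s+τ−r)R(r) dr`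
(`xs_combine`, `xs_pointwise_algebra`, part B) with `|R(r)| ≤ Λ(30+6Z)(1 + K + n⁻¹Σ‖vᵢ(r)‖³)` (part B:
raw linear terms, energy conservation `wc_kineticPP_flow`, flux groups integrated by the unit mass of
the ball kernel, `integral_ballAverage_eq`) and `0 ≤ s+τ−r ≤ τ` (`xs_final_bound`); interval
integrability along the orbit from `intervalIntegrable_sum_orbit`, `intervalIntegrable_momFlux_orbit`,
`intervalIntegrable_enFlux_orbit` (window `S = [s, s+τ]`, weighted tests) on a smoothness horizon
`t < t' ≤ T` of the rows (`exists_horizon_of_packing_lt`, `isSmoothSpaceTimeOn_logProfileRows`).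

No definitions, no named facts.  References: H.-T. Yau, Lett. Math. Phys. 22 (1991) §2; H. Spohn,
*Large Scale Dynamics of Interacting Particles* (1991), Part I §3.
-/

noncomputable section

namespace Summit.AtomisticToContinuum.HydrodynamicLimit.Theorems.NearConstantShortTimeHL

open scoped BigOperators ENNReal Topology
open MeasureTheory Set Filter
open Literature.MathematicalPhysics.KineticTheory Literature.Analysis.FluidPDE Literature.Analysis.FunctionSpaces

variable {ε : ℝ} {n : ℕ}

/-! ### The closure defects of the time-weighted rows -/

/-- **The momentum closure defect of the time-weighted row.** For a vector row `λ` jointly smooth on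
`[0, t') × 𝕋³`, `t' ≤ T`, and a window `[s, s+τ]`, `0 ≤ s`, `s + τ < t'`, by definition of `momDefect`
with the test `ψ_r = (s+τ−r) • λ_r` (`ψ_{s+τ} = 0`, `ψ_s = τ • λ_s`,
`∂ₜ^{[s,s+τ]}ψ = −λ + (s+τ−r) • ∂ₜ^{[0,T)}λ`, `xs_weighted`, `xs_mom_integrand`):
`momDefect = −τ Σⱼ(m_{Φ_s z}[λ_{s,j}])ⱼ − ∫_s^{s+τ} (−Σⱼ(m[λ_{r,j}])ⱼ + (s+τ−r)(Σⱼ(m[∂ₜλ_{r,j}])ⱼ + ∫ flux(λ_r))) dr`.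
[cite: Yau1991, §2] -/
theorem xs_momDefect_weighted {σ T t' : ℝ} {lam : ℝ → T3 → V3}
    (Φ : HardSphereFlow (Torus.geometry (Fin 3)) ε n) (z : Config n (Fin 3) T3) (ℓ : ℝ) {s τ : ℝ}
    (h1 : Torus.IsSmoothSpaceTimeOn (Set.Ico 0 t') lam) (ht'T : t' ≤ T) (hs : 0 ≤ s) (hτ : 0 < τ)
    (hst' : s + τ < t') :
    momDefect σ Φ z ℓ s τ (fun r y => (s + τ - r) • lam r y) =
      -(τ * ∑ j, (empiricalMomentumField (Φ.flow s z) (fun y => lam s y j)) j) -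
      ∫ r in s..(s + τ), (-(∑ j, (empiricalMomentumField (Φ.flow r z) (fun y => lam r y j)) j) +
        (s + τ - r) * ((∑ j, (empiricalMomentumField (Φ.flow r z)
          (fun y => Torus.timeDerivWithin (Set.Ico 0 T) lam r y j)) j) +
          ∫ x, ((∑ i, ∑ j, (Torus.partialDeriv i (lam r) x) j *
              (empiricalMomentumField (Φ.flow r z) (ballKernel ℓ x) i *
                empiricalMomentumField (Φ.flow r z) (ballKernel ℓ x) j /
                empiricalDensityField (Φ.flow r z) (ballKernel ℓ x))) +
            hsPressure σ (empiricalDensityField (Φ.flow r z) (ballKernel ℓ x))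
              (2 / 3 * (empiricalEnergyField (Φ.flow r z) (ballKernel ℓ x) /
                empiricalDensityField (Φ.flow r z) (ballKernel ℓ x) -
                ‖empiricalMomentumField (Φ.flow r z) (ballKernel ℓ x)‖ ^ 2 /
                  (2 * empiricalDensityField (Φ.flow r z) (ballKernel ℓ x) ^ 2))) *
              Torus.divergence (lam r) x))) := by
  obtain ⟨-, hder, -⟩ := xs_weighted (T := T) h1 ht'T hs hτ hst'
  have hsτ : s ≤ s + τ := by linarith
  have hb1 : (∑ j, (empiricalMomentumField (Φ.flow (s + τ) z)
      (fun y => ((s + τ - (s + τ)) • lam (s + τ) y) j)) j) = 0 := by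
    simp [empiricalMomentumField_apply_eq_sum]
  have hb0 : (∑ j, (empiricalMomentumField (Φ.flow s z) (fun y => ((s + τ - s) • lam s y) j)) j) =
      τ * ∑ j, (empiricalMomentumField (Φ.flow s z) (fun y => lam s y j)) j := by
    simp only [add_sub_cancel_left, PiLp.smul_apply, smul_eq_mul, we_empiricalMomentumField_const_mul,
      Finset.mul_sum]
  have hI : (∫ r in s..(s + τ), ((∑ j, (empiricalMomentumField (Φ.flow r z)
        (fun y => Torus.timeDerivWithin (Set.Icc s (s + τ)) (fun r y => (s + τ - r) • lam r y) r y j)) j) +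
        ∫ x, ((∑ i, ∑ j, (Torus.partialDeriv i (fun y => (s + τ - r) • lam r y) x) j *
            (empiricalMomentumField (Φ.flow r z) (ballKernel ℓ x) i *
              empiricalMomentumField (Φ.flow r z) (ballKernel ℓ x) j /
              empiricalDensityField (Φ.flow r z) (ballKernel ℓ x))) +
          hsPressure σ (empiricalDensityField (Φ.flow r z) (ballKernel ℓ x))
            (2 / 3 * (empiricalEnergyField (Φ.flow r z) (ballKernel ℓ x) /
              empiricalDensityField (Φ.flow r z) (ballKernel ℓ x) -
              ‖empiricalMomentumField (Φ.flow r z) (ballKernel ℓ x)‖ ^ 2 /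
                (2 * empiricalDensityField (Φ.flow r z) (ballKernel ℓ x) ^ 2))) *
            Torus.divergence (fun y => (s + τ - r) • lam r y) x))) =
      ∫ r in s..(s + τ), (-(∑ j, (empiricalMomentumField (Φ.flow r z) (fun y => lam r y j)) j) +
        (s + τ - r) * ((∑ j, (empiricalMomentumField (Φ.flow r z)
          (fun y => Torus.timeDerivWithin (Set.Ico 0 T) lam r y j)) j) +
          ∫ x, ((∑ i, ∑ j, (Torus.partialDeriv i (lam r) x) j *
              (empiricalMomentumField (Φ.flow r z) (ballKernel ℓ x) i *
                empiricalMomentumField (Φ.flow r z) (ballKernel ℓ x) j /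
                empiricalDensityField (Φ.flow r z) (ballKernel ℓ x))) +
            hsPressure σ (empiricalDensityField (Φ.flow r z) (ballKernel ℓ x))
              (2 / 3 * (empiricalEnergyField (Φ.flow r z) (ballKernel ℓ x) /
                empiricalDensityField (Φ.flow r z) (ballKernel ℓ x) -
                ‖empiricalMomentumField (Φ.flow r z) (ballKernel ℓ x)‖ ^ 2 /
                  (2 * empiricalDensityField (Φ.flow r z) (ballKernel ℓ x) ^ 2))) *
              Torus.divergence (lam r) x))) :=
    intervalIntegral.integral_congr fun r hr => by
      rw [Set.uIcc_of_le hsτ] at hr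
      exact xs_mom_integrand (Φ.flow r z) ℓ (ψ := fun r y => (s + τ - r) • lam r y) (lam := lam)
        (c := s + τ - r) (S := Set.Icc s (s + τ)) (S' := Set.Ico 0 T) rfl (hder r hr)
  show (∑ j, (empiricalMomentumField (Φ.flow (s + τ) z)
      (fun y => ((s + τ - (s + τ)) • lam (s + τ) y) j)) j) -
      (∑ j, (empiricalMomentumField (Φ.flow s z) (fun y => ((s + τ - s) • lam s y) j)) j) -
      (∫ r in s..(s + τ), ((∑ j, (empiricalMomentumField (Φ.flow r z)
        (fun y => Torus.timeDerivWithin (Set.Icc s (s + τ)) (fun r y => (s + τ - r) • lam r y) r y j)) j) +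
        ∫ x, ((∑ i, ∑ j, (Torus.partialDeriv i (fun y => (s + τ - r) • lam r y) x) j *
            (empiricalMomentumField (Φ.flow r z) (ballKernel ℓ x) i *
              empiricalMomentumField (Φ.flow r z) (ballKernel ℓ x) j /
              empiricalDensityField (Φ.flow r z) (ballKernel ℓ x))) +
          hsPressure σ (empiricalDensityField (Φ.flow r z) (ballKernel ℓ x))
            (2 / 3 * (empiricalEnergyField (Φ.flow r z) (ballKernel ℓ x) /
              empiricalDensityField (Φ.flow r z) (ballKernel ℓ x) -
              ‖empiricalMomentumField (Φ.flow r z) (ballKernel ℓ x)‖ ^ 2 /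
                (2 * empiricalDensityField (Φ.flow r z) (ballKernel ℓ x) ^ 2))) *
            Torus.divergence (fun y => (s + τ - r) • lam r y) x))) = _
  rw [hb1, hb0, hI]
  ring

/-- **The energy closure defect of the time-weighted row.** For a scalar row `λ⁴` jointly smooth on
`[0, t') × 𝕋³`, `t' ≤ T`, and a window `[s, s+τ]`, by definition of `enDefect` with the test
`φ_r = (s+τ−r) λ⁴_r` (`φ_{s+τ} = 0`, `φ_s = τ λ⁴_s`, `∂ₜ^{[s,s+τ]}φ = −λ⁴ + (s+τ−r) ∂ₜ^{[0,T)}λ⁴`):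
`enDefect = −τ e_{Φ_s z}[λ⁴_s] − ∫_s^{s+τ} (−e[λ⁴_r] + (s+τ−r)(e[∂ₜλ⁴_r] + ∫ (ẽ + p̃) Σᵢ (m̃ᵢ/ρ̃)(∇λ⁴_r)ᵢ)) dr`.
[cite: Yau1991, §2] -/
theorem xs_enDefect_weighted {σ T t' : ℝ} {lam4 : ℝ → T3 → ℝ}
    (Φ : HardSphereFlow (Torus.geometry (Fin 3)) ε n) (z : Config n (Fin 3) T3) (ℓ : ℝ) {s τ : ℝ}
    (h4 : Torus.IsSmoothSpaceTimeOn (Set.Ico 0 t') lam4) (ht'T : t' ≤ T) (hs : 0 ≤ s) (hτ : 0 < τ)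
    (hst' : s + τ < t') :
    enDefect σ Φ z ℓ s τ (fun r y => (s + τ - r) * lam4 r y) =
      -(τ * empiricalEnergyField (Φ.flow s z) (lam4 s)) -
      ∫ r in s..(s + τ), (-(empiricalEnergyField (Φ.flow r z) (lam4 r)) +
        (s + τ - r) * (empiricalEnergyField (Φ.flow r z) (Torus.timeDerivWithin (Set.Ico 0 T) lam4 r) +
          ∫ x, (empiricalEnergyField (Φ.flow r z) (ballKernel ℓ x) +
              hsPressure σ (empiricalDensityField (Φ.flow r z) (ballKernel ℓ x))
                (2 / 3 * (empiricalEnergyField (Φ.flow r z) (ballKernel ℓ x) /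
                  empiricalDensityField (Φ.flow r z) (ballKernel ℓ x) -
                  ‖empiricalMomentumField (Φ.flow r z) (ballKernel ℓ x)‖ ^ 2 /
                    (2 * empiricalDensityField (Φ.flow r z) (ballKernel ℓ x) ^ 2)))) *
            (∑ i, (empiricalMomentumField (Φ.flow r z) (ballKernel ℓ x) i /
              empiricalDensityField (Φ.flow r z) (ballKernel ℓ x)) * (Torus.gradient (lam4 r) x) i))) := by
  obtain ⟨-, hder, -⟩ := xs_weighted_mul (T := T) h4 ht'T hs hτ hst'
  have hsτ : s ≤ s + τ := by linarith
  have hb1 : empiricalEnergyField (Φ.flow (s + τ) z) (fun y => (s + τ - (s + τ)) * lam4 (s + τ) y) = 0 := by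
    simp [empiricalEnergyField_eq_sum]
  have hb0 : empiricalEnergyField (Φ.flow s z) (fun y => (s + τ - s) * lam4 s y) =
      τ * empiricalEnergyField (Φ.flow s z) (lam4 s) := by
    rw [add_sub_cancel_left, we_empiricalEnergyField_const_mul]
  have hI : (∫ r in s..(s + τ), (empiricalEnergyField (Φ.flow r z)
        (Torus.timeDerivWithin (Set.Icc s (s + τ)) (fun r y => (s + τ - r) * lam4 r y) r) +
        ∫ x, (empiricalEnergyField (Φ.flow r z) (ballKernel ℓ x) +
            hsPressure σ (empiricalDensityField (Φ.flow r z) (ballKernel ℓ x))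
              (2 / 3 * (empiricalEnergyField (Φ.flow r z) (ballKernel ℓ x) /
                empiricalDensityField (Φ.flow r z) (ballKernel ℓ x) -
                ‖empiricalMomentumField (Φ.flow r z) (ballKernel ℓ x)‖ ^ 2 /
                  (2 * empiricalDensityField (Φ.flow r z) (ballKernel ℓ x) ^ 2)))) *
          (∑ i, (empiricalMomentumField (Φ.flow r z) (ballKernel ℓ x) i /
            empiricalDensityField (Φ.flow r z) (ballKernel ℓ x)) *
            (Torus.gradient (fun y => (s + τ - r) * lam4 r y) x) i))) =
      ∫ r in s..(s + τ), (-(empiricalEnergyField (Φ.flow r z) (lam4 r)) +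
        (s + τ - r) * (empiricalEnergyField (Φ.flow r z) (Torus.timeDerivWithin (Set.Ico 0 T) lam4 r) +
          ∫ x, (empiricalEnergyField (Φ.flow r z) (ballKernel ℓ x) +
              hsPressure σ (empiricalDensityField (Φ.flow r z) (ballKernel ℓ x))
                (2 / 3 * (empiricalEnergyField (Φ.flow r z) (ballKernel ℓ x) /
                  empiricalDensityField (Φ.flow r z) (ballKernel ℓ x) -
                  ‖empiricalMomentumField (Φ.flow r z) (ballKernel ℓ x)‖ ^ 2 /
                    (2 * empiricalDensityField (Φ.flow r z) (ballKernel ℓ x) ^ 2)))) *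
            (∑ i, (empiricalMomentumField (Φ.flow r z) (ballKernel ℓ x) i /
              empiricalDensityField (Φ.flow r z) (ballKernel ℓ x)) * (Torus.gradient (lam4 r) x) i))) :=
    intervalIntegral.integral_congr fun r hr => by
      rw [Set.uIcc_of_le hsτ] at hr
      exact xs_en_integrand (Φ.flow r z) ℓ (φ := fun r y => (s + τ - r) * lam4 r y) (lam4 := lam4)
        (c := s + τ - r) (S := Set.Icc s (s + τ)) (S' := Set.Ico 0 T) rfl (hder r hr)
  show empiricalEnergyField (Φ.flow (s + τ) z) (fun y => (s + τ - (s + τ)) * lam4 (s + τ) y) -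
      empiricalEnergyField (Φ.flow s z) (fun y => (s + τ - s) * lam4 s y) -
      (∫ r in s..(s + τ), (empiricalEnergyField (Φ.flow r z)
        (Torus.timeDerivWithin (Set.Icc s (s + τ)) (fun r y => (s + τ - r) * lam4 r y) r) +
        ∫ x, (empiricalEnergyField (Φ.flow r z) (ballKernel ℓ x) +
            hsPressure σ (empiricalDensityField (Φ.flow r z) (ballKernel ℓ x))
              (2 / 3 * (empiricalEnergyField (Φ.flow r z) (ballKernel ℓ x) /
                empiricalDensityField (Φ.flow r z) (ballKernel ℓ x) -
                ‖empiricalMomentumField (Φ.flow r z) (ballKernel ℓ x)‖ ^ 2 /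
                  (2 * empiricalDensityField (Φ.flow r z) (ballKernel ℓ x) ^ 2)))) *
          (∑ i, (empiricalMomentumField (Φ.flow r z) (ballKernel ℓ x) i /
            empiricalDensityField (Φ.flow r z) (ballKernel ℓ x)) *
            (Torus.gradient (fun y => (s + τ - r) * lam4 r y) x) i))) = _
  rw [hb1, hb0, hI]
  ring

/-! ### The registered stub -/

/-- **Registered stub `weightedCell_bound`: the pathwise cell bound of the discretised relative-entropy
Grönwall.** Along a classical hard-sphere–Euler solution in the analyticity band on `[0, t]` there is
`C > 0` (depending on the solution data only: the coefficient bound `Λ` of `wb_coeffs` and the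
compressibility bound `Z` on `[0, η₁]`) such that for every good orbit with `n ≥ 1` particles, every
cell `[s, s+τ] ⊆ [0, t]` and every ball radius `0 < ℓ < 1/2` at which the ball-packing cap
`ρ̃σ³ ≤ η₁` holds on the cell: `r ↦ X_r(Φ_r z)` and the cubic moment `r ↦ n⁻¹Σᵢ‖vᵢ(r)‖³` are
interval integrable on the cell, and
`|∫_s^{s+τ} X_r(Φ_r z) dr − τ X_s(Φ_s z) − momDefect[(s+τ−r)λ] − enDefect[(s+τ−r)λ⁴]|`
`≤ C τ (τ(1 + K(z)) + ∫_s^{s+τ} n⁻¹Σᵢ‖vᵢ(r)‖³ dr)`.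
Proof: the three weak balance rows along the orbit with the TIME-WEIGHTED tests `(s+τ−r)λ⁰_r`
(mass row, exact: `weightedCell_massRow`), `(s+τ−r)•λ_r` and `(s+τ−r)λ⁴_r` (momentum and energy rows,
by definition of the closure defects: `xs_momDefect_weighted`, `xs_enDefect_weighted`); the `−row`
parts of the product rule `∂ₜ((s+τ−r)f) = −f + (s+τ−r)∂ₜf` reproduce `−∫X`, the endpoint terms give
`−τX_s`, and what is left is `∫_s^{s+τ} (s+τ−r) R(r) dr` (`xs_combine`, `xs_pointwise_algebra`) with
`|R(r)| ≤ Λ(30 + 6Z)(1 + K + n⁻¹Σ‖vᵢ(r)‖³)` (raw linear terms `xs_abs_density_le`,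
`xs_abs_mom_sum_le`, `xs_abs_energy_le`, energy conservation `wc_kineticPP_flow`; flux groups
`weightedCell_momFluxSize`, `xs_abs_enFlux_le` integrated with `∫ẽ = K`, `∫c̃ = n⁻¹Σ‖vᵢ‖³`,
`integral_ballAverage_eq`), and `0 ≤ s+τ−r ≤ τ` (`xs_final_bound`). [cite: Yau1991, §2] -/
theorem weightedCell_bound : ∀ {η₀ : ℝ} {F : ℝ → ℝ}, 0 < η₀ → AnalyticOnNhd ℝ F (Set.Ioo (-η₀) η₀) → Set.EqOn hsExcessFreeEnergy F (Set.Ico 0 η₀) → ∀ {σ T : ℝ}, 0 < σ → ∀ {ρ θ : ℝ → T3 → ℝ} {u : ℝ → T3 → V3}, IsHardSphereEulerSolution σ T ρ u θ → ∀ {t : ℝ}, t ∈ Set.Ico 0 T → (∀ s ∈ Set.Icc 0 t, ∀ x, ρ s x * σ ^ 3 < η₀) → ∀ {η₁ : ℝ}, 0 < η₁ → η₁ < η₀ → ∃ C : ℝ, 0 < C ∧ ∀ {ε : ℝ} {n : ℕ} (Φ : HardSphereFlow (Torus.geometry (Fin 3)) ε n) {z : Config n (Fin 3) T3}, z ∈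 Φ.good → n ≠ 0 → ∀ {s τ : ℝ}, 0 ≤ s → 0 < τ → s + τ ≤ t → ∀ {ℓ : ℝ}, 0 < ℓ → ℓ < 1 / 2 → packCapOn Φ z (Set.Icc s (s + τ)) ℓ σ η₁ → IntervalIntegrable (fun r => logProfileObs σ ρ θ u r (Φ.flow r z)) volume s (s + τ) ∧ IntervalIntegrable (fun r => (n : ℝ)⁻¹ * ∑ i, ‖((Φ.flow r z) i).2‖ ^ 3) volume s (s + τ) ∧ |(∫ r in s..(s + τ), logProfileObs σ ρ θ u r (Φ.flow r z)) - τ * logProfileObs σ ρ θ u s (Φ.flow s z) - momDefect σ Φ z ℓ s τ (fun r y => (s + τ - r) • lamRow θ u r y) - enDefect σ Φ z ℓ s τ (fun r y => (s + τ - r) * lam4Row θ r y)| ≤ C * τ * (τ * (1 + kineticPP z) + ∫ r in s..(s + τ), (n : ℝ)⁻¹ * ∑ i, ‖((Φ.flow r z) i).2‖ ^ 3) := by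
  intro η₀ F hη₀ hFa hEq σ T hσ ρ θ u hE t ht hband η₁ hη₁ hη₁₀
  -- (0) data of the solution on `[0, t] × 𝕋³`: coefficient bound, compressibility bound, horizon
  obtain ⟨Λ, hΛ0, hcoef⟩ := wb_coeffs hη₀ hFa hEq hσ hE ht hband
  obtain ⟨Z, hZ0, hZ⟩ := wf_exists_compressibility_bound hFa hEq hη₁ hη₁₀
  obtain ⟨t', htt', ht'T, hband'⟩ := exists_horizon_of_packing_lt hE hσ ht hband
  obtain ⟨h0, h1, h4⟩ := isSmoothSpaceTimeOn_logProfileRows hη₀ hFa hEq hσ hE ht'T hband'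
  have h0' : Torus.IsSmoothSpaceTimeOn (Set.Ico 0 t') (lam0Row σ ρ θ u) := h0
  have h1' : Torus.IsSmoothSpaceTimeOn (Set.Ico 0 t') (lamRow θ u) := h1
  have h4' : Torus.IsSmoothSpaceTimeOn (Set.Ico 0 t') (lam4Row θ) := h4
  have hΛ : 0 ≤ Λ := hΛ0.le
  have hσ3 : 0 < σ ^ 3 := pow_pos hσ 3
  refine ⟨Λ * (30 + 6 * Z), by positivity, ?_⟩
  intro ε n Φ z hz hn s τ hs hτ hst ℓ hℓ0 hℓ hcap
  have hsτ : s ≤ s + τ := by linarith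
  have hst' : s + τ < t' := lt_of_le_of_lt hst htt'
  have hwin : Set.Icc s (s + τ) ⊆ Set.Icc 0 t := fun r hr => ⟨hs.trans hr.1, hr.2.trans hst⟩
  have hwin' : Set.Icc s (s + τ) ⊆ Set.Ico 0 t' := fun r hr => ⟨hs.trans hr.1, hr.2.trans_lt hst'⟩
  -- (1) slab continuity of the rows and of their derivatives; the weighted tests
  obtain ⟨c0, -, -⟩ := xs_slab (T := T) h0' ht'T hs hst'
  obtain ⟨c1, -, -⟩ := xs_slab (T := T) h1' ht'T hs hst'
  obtain ⟨c4, -, -⟩ := xs_slab (T := T) h4' ht'T hs hst'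
  obtain ⟨-, hdM, hψs, hψt, hψx⟩ := xs_weighted (T := T) h1' ht'T hs hτ hst'
  obtain ⟨-, hdE, hφs, hφt, hφx⟩ := xs_weighted_mul (T := T) h4' ht'T hs hτ hst'
  -- (2) interval integrability of the raw pairings and of the cubic moment
  have hIP : IntervalIntegrable (fun r => empiricalDensityField (Φ.flow r z) (lam0Row σ ρ θ u r))
      volume s (s + τ) := xs_ii_density Φ hz hsτ c0
  have hIA : IntervalIntegrable
      (fun r => ∑ j, (empiricalMomentumField (Φ.flow r z) (fun y => lamRow θ u r y j)) j)
      volume s (s + τ) :=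
    xs_ii_momentum Φ hz hsτ (g := fun j r y => lamRow θ u r y j) fun j =>
      (PiLp.continuous_apply 2 _ j).comp_continuousOn c1
  have hIE : IntervalIntegrable (fun r => empiricalEnergyField (Φ.flow r z) (lam4Row θ r))
      volume s (s + τ) := xs_ii_energy Φ hz hsτ c4
  have hIX : IntervalIntegrable (fun r => logProfileObs σ ρ θ u r (Φ.flow r z)) volume s (s + τ) :=
    (hIP.add hIA).add hIE
  have hIc : IntervalIntegrable (fun r => (n : ℝ)⁻¹ * ∑ i, ‖((Φ.flow r z) i).2‖ ^ 3)
      volume s (s + τ) := by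
    have hG : Continuous fun v : V3 => ‖v‖ ^ 3 := continuous_norm.pow 3
    have h := (intervalIntegrable_sum_orbit Φ hz hsτ (g := fun _ _ => (1 : ℝ)) continuousOn_const
      hG).const_mul ((n : ℝ)⁻¹)
    simpa only [one_mul] using h
  -- (3) the three rows with the weighted tests; integrability of their time integrands
  obtain ⟨hID, hmass⟩ := weightedCell_massRow (T := T) Φ hz h0' ht'T hs hτ hst'
  have hmom := xs_momDefect_weighted (σ := σ) (T := T) Φ z ℓ h1' ht'T hs hτ hst'
  have hen := xs_enDefect_weighted (σ := σ) (T := T) Φ z ℓ h4' ht'T hs hτ hst'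
  have hIMraw := intervalIntegrable_momFlux_orbit hη₀ hFa hEq hσ hη₁ hη₁₀ Φ hz hsτ hℓ0 hℓ hcap
    hψs hψt hψx
  have hIEraw := intervalIntegrable_enFlux_orbit hη₀ hFa hEq hσ hη₁ hη₁₀ Φ hz hsτ hℓ0 hℓ hcap
    hφs hφt hφx
  have hIM : IntervalIntegrable (fun r =>
      -(∑ j, (empiricalMomentumField (Φ.flow r z) (fun y => lamRow θ u r y j)) j) +
        (s + τ - r) * ((∑ j, (empiricalMomentumField (Φ.flow r z)
          (fun y => Torus.timeDerivWithin (Set.Ico 0 T) (lamRow θ u) r y j)) j) +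
          ∫ x, ((∑ i, ∑ j, (Torus.partialDeriv i (lamRow θ u r) x) j *
              (empiricalMomentumField (Φ.flow r z) (ballKernel ℓ x) i *
                empiricalMomentumField (Φ.flow r z) (ballKernel ℓ x) j /
                empiricalDensityField (Φ.flow r z) (ballKernel ℓ x))) +
            hsPressure σ (empiricalDensityField (Φ.flow r z) (ballKernel ℓ x))
              (2 / 3 * (empiricalEnergyField (Φ.flow r z) (ballKernel ℓ x) /
                empiricalDensityField (Φ.flow r z) (ballKernel ℓ x) -
                ‖empiricalMomentumField (Φ.flow r z) (ballKernel ℓ x)‖ ^ 2 /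
                  (2 * empiricalDensityField (Φ.flow r z) (ballKernel ℓ x) ^ 2))) *
              Torus.divergence (lamRow θ u r) x))) volume s (s + τ) := by
    rw [intervalIntegrable_iff_integrableOn_Icc_of_le hsτ] at hIMraw ⊢
    exact hIMraw.congr_fun (fun r hr => xs_mom_integrand (Φ.flow r z) ℓ
      (ψ := fun r y => (s + τ - r) • lamRow θ u r y) (lam := lamRow θ u) (c := s + τ - r)
      (S := Set.Icc s (s + τ)) (S' := Set.Ico 0 T) rfl (hdM r hr)) measurableSet_Icc
  have hIN : IntervalIntegrable (fun r => -(empiricalEnergyField (Φ.flow r z) (lam4Row θ r)) +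
      (s + τ - r) * (empiricalEnergyField (Φ.flow r z) (Torus.timeDerivWithin (Set.Ico 0 T) (lam4Row θ) r) +
        ∫ x, (empiricalEnergyField (Φ.flow r z) (ballKernel ℓ x) +
            hsPressure σ (empiricalDensityField (Φ.flow r z) (ballKernel ℓ x))
              (2 / 3 * (empiricalEnergyField (Φ.flow r z) (ballKernel ℓ x) /
                empiricalDensityField (Φ.flow r z) (ballKernel ℓ x) -
                ‖empiricalMomentumField (Φ.flow r z) (ballKernel ℓ x)‖ ^ 2 /
                  (2 * empiricalDensityField (Φ.flow r z) (ballKernel ℓ x) ^ 2)))) *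
          (∑ i, (empiricalMomentumField (Φ.flow r z) (ballKernel ℓ x) i /
            empiricalDensityField (Φ.flow r z) (ballKernel ℓ x)) * (Torus.gradient (lam4Row θ r) x) i)))
      volume s (s + τ) := by
    rw [intervalIntegrable_iff_integrableOn_Icc_of_le hsτ] at hIEraw ⊢
    exact hIEraw.congr_fun (fun r hr => xs_en_integrand (Φ.flow r z) ℓ
      (φ := fun r y => (s + τ - r) * lam4Row θ r y) (lam4 := lam4Row θ) (c := s + τ - r)
      (S := Set.Icc s (s + τ)) (S' := Set.Ico 0 T) rfl (hdE r hr)) measurableSet_Icc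
  -- (4) the goal as one window integral of `(s+τ-r)·R(r)`
  refine ⟨hIX, hIc, ?_⟩
  have hXs : logProfileObs σ ρ θ u s (Φ.flow s z) =
      empiricalDensityField (Φ.flow s z) (lam0Row σ ρ θ u s) +
        (∑ j, (empiricalMomentumField (Φ.flow s z) (fun y => lamRow θ u s y j)) j) +
        empiricalEnergyField (Φ.flow s z) (lam4Row θ s) := rfl
  rw [hmom, hen, hXs, xs_combine hIX hID hIM hIN hmass]
  refine xs_final_bound hτ hIc fun r hr => ?_
  -- (5) the pointwise bound on `(s, s+τ]`
  have hrI : r ∈ Set.Icc s (s + τ) := ⟨hr.1.le, hr.2⟩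
  have hr0t : r ∈ Set.Icc 0 t := hwin hrI
  have hr0' : r ∈ Set.Ico 0 t' := hwin' hrI
  have hw0 : 0 ≤ s + τ - r := by linarith [hr.2]
  have hwτ : s + τ - r ≤ τ := by linarith [hr.1]
  obtain ⟨hbd, -, -, -, -, -, -⟩ := hcoef r hr0t
  have hK : kineticPP (Φ.flow r z) = kineticPP z := wc_kineticPP_flow Φ hz r
  have hK0 : 0 ≤ kineticPP z := by unfold kineticPP; positivity
  have hcub0 : 0 ≤ (n : ℝ)⁻¹ * ∑ i, ‖((Φ.flow r z) i).2‖ ^ 3 := by positivity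
  -- raw linear terms
  have b1 : |empiricalDensityField (Φ.flow r z)
      (Torus.timeDerivWithin (Set.Ico 0 T) (lam0Row σ ρ θ u) r)| ≤ Λ :=
    xs_abs_density_le _ hΛ fun x => (hbd x).1
  have b2 : |∑ k, (empiricalMomentumField (Φ.flow r z)
      (Torus.partialDeriv k (lam0Row σ ρ θ u r))) k| ≤ 3 * Λ * (1 / 2 + kineticPP (Φ.flow r z)) :=
    xs_abs_mom_sum_le hn _ (g := fun k => Torus.partialDeriv k (lam0Row σ ρ θ u r)) hΛ
      fun k x => (hbd x).2.2.2.1 k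
  have b3 : |∑ j, (empiricalMomentumField (Φ.flow r z)
      (fun y => Torus.timeDerivWithin (Set.Ico 0 T) (lamRow θ u) r y j)) j| ≤
      3 * Λ * (1 / 2 + kineticPP (Φ.flow r z)) :=
    xs_abs_mom_sum_le hn _ (g := fun j y => Torus.timeDerivWithin (Set.Ico 0 T) (lamRow θ u) r y j) hΛ
      fun j x => (hbd x).2.1 j
  have b4 : |empiricalEnergyField (Φ.flow r z) (Torus.timeDerivWithin (Set.Ico 0 T) (lam4Row θ) r)| ≤
      Λ * kineticPP (Φ.flow r z) :=
    xs_abs_energy_le _ fun x => (hbd x).2.2.1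
  -- the two flux groups
  have hS1 : Torus.IsSmooth (lamRow θ u r) := h1'.isSmooth_slice hr0'
  have hS4 : Torus.IsSmooth (lam4Row θ r) := h4'.isSmooth_slice hr0'
  have hZx : ∀ x, |hsCompressibility (empiricalDensityField (Φ.flow r z) (ballKernel ℓ x) * σ ^ 3)| ≤ Z :=
    fun x => hZ _ ⟨mul_nonneg (ballDensity_nonneg ℓ x _) hσ3.le, hcap r hrI x⟩
  have hdiv : ∀ x, |Torus.divergence (lamRow θ u r) x| ≤ 3 * Λ := fun x => by
    rw [Torus.divergence_eq_sum_partialDeriv_apply (hS1.isContDiff (by simp)) x]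
    refine (Finset.abs_sum_le_sum_abs _ _).trans ?_
    calc ∑ k, |Torus.partialDeriv k (lamRow θ u r) x k| ≤ ∑ _k : Fin 3, Λ :=
          Finset.sum_le_sum fun k _ => (hbd x).2.2.2.2.1 k k
      _ = 3 * Λ := by
          simp only [Finset.sum_const, Finset.card_univ, Fintype.card_fin, nsmul_eq_mul, Nat.cast_ofNat]
  have hgrad : ∀ x i, |(Torus.gradient (lam4Row θ r) x) i| ≤ Λ := fun x i => by
    rw [Torus.gradient_apply (hS4.isContDiff (by simp)) x i]
    exact (hbd x).2.2.2.2.2 i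
  have b5 : |∫ x, ((∑ i, ∑ j, (Torus.partialDeriv i (lamRow θ u r) x) j *
        (empiricalMomentumField (Φ.flow r z) (ballKernel ℓ x) i *
          empiricalMomentumField (Φ.flow r z) (ballKernel ℓ x) j /
          empiricalDensityField (Φ.flow r z) (ballKernel ℓ x))) +
      hsPressure σ (empiricalDensityField (Φ.flow r z) (ballKernel ℓ x))
        (2 / 3 * (empiricalEnergyField (Φ.flow r z) (ballKernel ℓ x) /
          empiricalDensityField (Φ.flow r z) (ballKernel ℓ x) -
          ‖empiricalMomentumField (Φ.flow r z) (ballKernel ℓ x)‖ ^ 2 /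
            (2 * empiricalDensityField (Φ.flow r z) (ballKernel ℓ x) ^ 2))) *
        Torus.divergence (lamRow θ u r) x)| ≤ Λ * (18 + 2 * Z) * kineticPP (Φ.flow r z) := by
    have hIe : Integrable fun x => empiricalEnergyField (Φ.flow r z) (ballKernel ℓ x) := by
      simpa using integrable_mul_ballEnergy ℓ (continuous_const (y := (1 : ℝ))) (Φ.flow r z)
    rw [← xs_integral_ballEnergy hℓ0 hℓ (Φ.flow r z)]
    exact xs_abs_integral_le hIe fun x =>
      weightedCell_momFluxSize ℓ x (Φ.flow r z) (fun i j => (hbd x).2.2.2.2.1 i j) (hdiv x) hZ0 (hZx x)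
  have b6 : |∫ x, (empiricalEnergyField (Φ.flow r z) (ballKernel ℓ x) +
        hsPressure σ (empiricalDensityField (Φ.flow r z) (ballKernel ℓ x))
          (2 / 3 * (empiricalEnergyField (Φ.flow r z) (ballKernel ℓ x) /
            empiricalDensityField (Φ.flow r z) (ballKernel ℓ x) -
            ‖empiricalMomentumField (Φ.flow r z) (ballKernel ℓ x)‖ ^ 2 /
              (2 * empiricalDensityField (Φ.flow r z) (ballKernel ℓ x) ^ 2)))) *
      (∑ i, (empiricalMomentumField (Φ.flow r z) (ballKernel ℓ x) i /
        empiricalDensityField (Φ.flow r z) (ballKernel ℓ x)) * (Torus.gradient (lam4Row θ r) x) i)| ≤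
      Λ * (3 / 2 + Z) * ((n : ℝ)⁻¹ * ∑ i, ‖((Φ.flow r z) i).2‖ ^ 3) := by
    rw [← integral_ballAverage_eq hℓ0 hℓ (fun v => ‖v‖ ^ 3) (Φ.flow r z)]
    exact xs_abs_integral_le (wb_integrable_ballAverage ℓ (Φ.flow r z) fun v => ‖v‖ ^ 3).2 fun x =>
      xs_abs_enFlux_le ℓ x (Φ.flow r z) (hgrad x) hZ0 (hZx x)
  rw [hK] at b2 b3 b4 b5
  -- (6) assemble
  unfold logProfileObs
  refine (xs_pointwise_algebra hw0 (xs_pointwise_bound hΛ hZ0 hK0 hcub0 b1 b2 b3 b5 b4 b6)).trans ?_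
  exact mul_le_mul_of_nonneg_right hwτ (mul_nonneg (mul_nonneg hΛ (by positivity)) (by linarith))

end Summit.AtomisticToContinuum.HydrodynamicLimit.Theorems.NearConstantShortTimeHL

end
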